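import Summits.HodgeConjecture.HodgeConjecture.Theorems.Ring2WeilCoverageNormTableC
import HarnessLib

/-!
# Weil-type family coverage — residual rows, part B: the quaternionic signature lemma (PROPOSITION T2 (i)), the all-inner split row (LEMMA IO (iv)), the type-(c2) symbol, the all-`N` bound (ring2-b02, gen 67)

research route conditional on HC_CM; not a corollary; Q11.4-sentence-2 already refuted in dim ≥ 3.

Companion of `Ring2WeilCoverageResidualRowClosure` (block b02.27 of `HOME/WEIL-FAMILY-COVERAGE.md` `## b02 (g = 6)`).
* §1 **PROPOSITION T2 (i) / the type-II–III signature mechanism.** An element `k` of an imaginary quadratic field `K ⊂ 𝔻` acts, through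
  `𝔻 ⊗ ℝ → M₂(ℝ)` (type II) on `ℝ²`, by a real `2 × 2` matrix `A` with `A² = -q·1`, `q > 0`.  Such a matrix has trace `0` and determinant
  `q` (§1): its characteristic polynomial is `X² + q`, its complex eigenvalues are `i√q` and `-i√q`, ONE EACH — so on `H^{1,0} = ℂ² ⊗ U` the
  field `K` acts with signature `(dim U, dim U)`: the hidden factor of a type-II (or type-III) window is of Weil type `(m/2, m/2)` for EVERY
  `K ⊂ 𝔻`, with no Chevalley–Weil signature condition.
* §2 **LEMMA IO (iv).** If all branch classes are inner, the `K`-form of the hidden sixfold is `√-q·E₀ ⊗ 1` on `H₁(B₀) ⊗ K`, of determinant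
  `(√-q)⁶·pf(E₀)² = -q³·pf²`; the census invariant `a = (-1)³ det = q³ pf²` is a NORM from `K = ℚ(√-q)` (`q = 0² + q·1²`): the split row.
* §3 **Type (c2).** `𝔻(χ₁₆) = (-2,-13)_ℚ` for `2.L2(13).2`: `-c = 13` is NOT a norm from `ℚ(√-2)` (tree: ring2-b02's
  `thirteen_not_mem_norm_two` / `SqrtNeg2`), but the symbols `(-c)^{k}` with `k ∈ {0, 2, 6}` even are trivial: `13⁶`, `13²` are squares.
* §4 **The all-`N` bound.** `N·w_min ≤ Σ w_j = 2d + 6` gives `N ≤ (2d+6)/w_min` (the scan's `N_max`).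

Nothing here is a statement about Hodge classes; `HC_CM` is used nowhere; no `def`, no named fact.
References: [cite: vanGeemen1994HodgeAV, 5.2 and (5.4.1)].
-/

noncomputable section

set_option linter.dupNamespace false

open Literature.AlgebraicGeometry.Motives
open Literature.AlgebraicGeometry.VanGeemen1994
open Summit.HodgeConjecture.HodgeConjecture.Ring2.Hypotheses

namespace Summit.HodgeConjecture.HodgeConjecture.Ring2.WeilCoverage

namespace ResidualClosure

/-! ### §1 The signature lemma: real `2 × 2` matrices with `A² = -q` -/

/-- **PROPOSITION T2 (i), the load-bearing matrix fact.** A real `2 × 2` matrix `A` with `A·A = -q·1`, `q > 0`, has trace `0` and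
determinant `q`: if `a + d ≠ 0` the off-diagonal equations force `b = c = 0` and `a² = -q < 0`, absurd; so `d = -a` and
`det = ad - bc = -(a² + bc) = q`.  Hence `χ_A = X² + q` and the complex eigenvalues are `± i√q`, one each.
research route conditional on HC_CM; not a corollary; Q11.4-sentence-2 already refuted in dim ≥ 3. [folklore] -/
theorem trace_zero_det_eq_of_sq_eq_neg (q a b c d : ℝ) (hq : 0 < q)
    (h : !![a, b; c, d] * !![a, b; c, d] = !![-q, 0; 0, -q]) :
    a + d = 0 ∧ a * d - b * c = q := by
  have h11 := congrArg (fun M => M 0 0) h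
  have h12 := congrArg (fun M => M 0 1) h
  have h21 := congrArg (fun M => M 1 0) h
  have h22 := congrArg (fun M => M 1 1) h
  simp [Matrix.mul_apply, Fin.sum_univ_two] at h11 h12 h21 h22
  -- h11 : a*a + b*c = -q ; h12 : a*b + b*d = 0 ; h21 : c*a + d*c = 0 ; h22 : c*b + d*d = -q
  have htr : a + d = 0 := by
    by_contra hne
    have hb : b = 0 := by
      have : b * (a + d) = 0 := by linear_combination h12
      rcases mul_eq_zero.1 this with hb | hs
      · exact hb
      · exact absurd hs hne
    have hc : c = 0 := by
      have : c * (a + d) = 0 := by linear_combination h21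
      rcases mul_eq_zero.1 this with hc | hs
      · exact hc
      · exact absurd hs hne
    have ha : a * a = -q := by rw [hb, zero_mul, add_zero] at h11; exact h11
    nlinarith [mul_self_nonneg a]
  refine ⟨htr, ?_⟩
  have hd : d = -a := by linear_combination htr
  subst hd
  linear_combination -h11

/-- **Corollary (the Weil signature of a quaternionic hidden factor).** With trace `0` and determinant `q > 0` the discriminant of the
characteristic polynomial is `tr² - 4·det = -4q < 0`: no real eigenvalue, two distinct complex-conjugate eigenvalues `± i√q` — the element
`√-q ∈ K ⊂ 𝔻` acts on each `𝔻 ⊗ ℝ ≅ M₂(ℝ)`-line with both embeddings once, so `K` has signature `(m/2, m/2)` on `H^{1,0}(B) = ℂ² ⊗ U`.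
research route conditional on HC_CM; not a corollary; Q11.4-sentence-2 already refuted in dim ≥ 3. [folklore] -/
theorem charpoly_disc_neg_of_sq_eq_neg (q a b c d : ℝ) (hq : 0 < q)
    (h : !![a, b; c, d] * !![a, b; c, d] = !![-q, 0; 0, -q]) :
    (a + d) ^ 2 - 4 * (a * d - b * c) < 0 := by
  obtain ⟨htr, hdet⟩ := trace_zero_det_eq_of_sq_eq_neg q a b c d hq h
  rw [htr, hdet]; nlinarith

/-- The model case: `√-q` acts on `K ⊗ ℝ = ℝ²` (basis `1, √-q`) by `A = [[0, -q], [1, 0]]`, and indeed `A·A = -q·1`.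
research route conditional on HC_CM; not a corollary; Q11.4-sentence-2 already refuted in dim ≥ 3. [folklore] -/
theorem sqrtNeg_matrix_sq (q : ℝ) : !![(0 : ℝ), -q; 1, 0] * !![(0 : ℝ), -q; 1, 0] = !![-q, 0; 0, -q] := by
  ext i j; fin_cases i <;> fin_cases j <;> simp [Matrix.mul_apply, Fin.sum_univ_two]

/-! ### §2 LEMMA IO (iv): an all-inner tuple lands on the split row -/

/-- **LEMMA IO (iv), the determinant.** `det(√-q·E₀ ⊗ 1) = (√-q)⁶·det E₀ = -q³·pf²` on the `K`-span of `H₁` of an abelian threefold; the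
census invariant of a sixfold row is `a = (-1)³·det H = q³·pf²`, and `q³ pf² = q·(q·pf)²`.
research route conditional on HC_CM; not a corollary; Q11.4-sentence-2 already refuted in dim ≥ 3. [folklore] -/
theorem allInner_invariant_eq (q pf : ℚ) : q ^ 3 * pf ^ 2 = q * (q * pf) ^ 2 := by ring

/-- **LEMMA IO (iv): the all-inner hidden sixfold is on the SPLIT row** — `q³·pf²` is a norm from `K = ℚ(√-q)` (`q = 0² + q·1²`, times a
square), for every squarefree `q` (stated for the carrier fields `q = 2, 7, 11` of the census at once: any `q`).
research route conditional on HC_CM; not a corollary; Q11.4-sentence-2 already refuted in dim ≥ 3. [cite: vanGeemen1994HodgeAV, (5.4.1)] -/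
theorem allInner_invariant_mem_norm (q : ℕ) (hq : (q : ℚ) ≠ 0) (pf : ℚ) (hpf : pf ≠ 0) :
    Units.mk0 ((q : ℚ) ^ 3 * pf ^ 2) (mul_ne_zero (pow_ne_zero 3 hq) (pow_ne_zero 2 hpf)) ∈
      normUnitsSubgroup ℚ (weilField q) := by
  have hq1 : Units.mk0 (q : ℚ) hq ∈ normUnitsSubgroup ℚ (weilField q) :=
    mem_normUnitsSubgroup_of_sq_add_mul_sq (d := q) hq 0 1 (by ring)
  have hsq := sq_mem_normUnitsSubgroup (d := q) (q := (q : ℚ) * pf) (mul_ne_zero hq hpf)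
  have e : Units.mk0 ((q : ℚ) ^ 3 * pf ^ 2) (mul_ne_zero (pow_ne_zero 3 hq) (pow_ne_zero 2 hpf)) =
      Units.mk0 (q : ℚ) hq * Units.mk0 (((q : ℚ) * pf) ^ 2) (pow_ne_zero 2 (mul_ne_zero hq hpf)) := by
    ext; simp only [Units.val_mul, Units.val_mk0]; ring
  rw [e]; exact Subgroup.mul_mem _ hq1 hsq

/-- **LEMMA IO (iv) at the class level, `K = ℚ(√-2)`:** the all-inner datum's class `[(-1)³·(-2)³·pf²] = [8 pf²]` IS the split class
`splitDiscriminantClass 3 2` — e.g. the three dead `2.F4(2).2` data sit on `W6.2.1`, not on `W6.2.91`.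
research route conditional on HC_CM; not a corollary; Q11.4-sentence-2 already refuted in dim ≥ 3. [cite: vanGeemen1994HodgeAV, (5.4.1)] -/
theorem allInner_class_eq_split_sqrtNeg2 (pf : ℚ) (hpf : pf ≠ 0) :
    (QuotientGroup.mk (Units.mk0 (-((2 : ℚ) ^ 3 * pf ^ 2))
        (neg_ne_zero.2 (mul_ne_zero (by norm_num) (pow_ne_zero 2 hpf)))) : weilNormResidueGroup 2) =
      splitDiscriminantClass 3 2 := by
  have hne : (2 : ℚ) ^ 3 * pf ^ 2 ≠ 0 := mul_ne_zero (by norm_num) (pow_ne_zero 2 hpf)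
  have hm := allInner_invariant_mem_norm 2 (by norm_num) pf hpf
  have hm' : Units.mk0 ((2 : ℚ) ^ 3 * pf ^ 2) hne ∈ normUnitsSubgroup ℚ (weilField 2) := by
    convert hm using 2; push_cast; rfl
  exact mk_neg_eq_split_of_odd (d := 2) (n := 3) (by decide) hne hm'

/-! ### §3 Type (c2): the symbols of `𝔻(χ₁₆) = (-2, -13)_ℚ` -/

/-- **Type (c2), `2.L2(13).2`:** `𝔻(χ₁₆) ≅ (-2, -13)_ℚ`, so `-c = 13`, which is NOT a norm from `ℚ(√-2)` (the tree's
`Summit.HodgeConjecture.Ring2WeilNormDescent.thirteen_not_mem_norm_two`, not restated) — a `D±`-symbol `13^{k}` with `k` ODD would put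
`13` into `T`; but every `k_±(y) = mult_{±1}(χ₁₆(y))/2` is `0`, `2` or `6`, and `det ≡ 13⁶`: these symbols are SQUARES, hence trivial.
research route conditional on HC_CM; not a corollary; Q11.4-sentence-2 already refuted in dim ≥ 3. [cite: vanGeemen1994HodgeAV, (5.4.1)] -/
theorem typeC2_symbols_eq_one :
    (QuotientGroup.mk (Units.mk0 ((13 : ℚ) ^ 6) (by norm_num)) : weilNormResidueGroup 2) = 1 ∧
    (QuotientGroup.mk (Units.mk0 ((13 : ℚ) ^ 2) (by norm_num)) : weilNormResidueGroup 2) = 1 := by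
  refine ⟨?_, ?_⟩
  · rw [QuotientGroup.eq_one_iff]
    have hsq := sq_mem_normUnitsSubgroup (d := 2) (q := (13 : ℚ) ^ 3) (by norm_num)
    have e : Units.mk0 ((13 : ℚ) ^ 6) (by norm_num) = Units.mk0 (((13 : ℚ) ^ 3) ^ 2) (by norm_num) := by
      ext; norm_num
    rw [e]; exact hsq
  · rw [QuotientGroup.eq_one_iff]
    exact sq_mem_normUnitsSubgroup (d := 2) (q := (13 : ℚ)) (by norm_num)

/-- `(-2, -13)_ℚ` is ramified at `13` (`-2` is a non-square mod `13`) and split at `7` (`-2·1² - 13·1² = -15 ≡ 1·…`: a unit; more to the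
point `χ₁₆ mod 7` is absolutely irreducible, kit j225396) — the residue facts in the kernel: `-2` non-square mod 13, `-2 ≡ 3²` is a square mod 11
(so `ℚ(√-2) ⊄ D` for any `D` ramified at 11), and `-15 ≡ 1 (mod 8)` (the 2-adic unit `-13 - 2·1²` is `≡ 1 mod 8`, a 2-adic square: `(-2,-13)_2 = +1`).
research route conditional on HC_CM; not a corollary; Q11.4-sentence-2 already refuted in dim ≥ 3. [cite: Serre1973, Ch. III §1] -/
theorem dChi16_residue_facts :
    ¬ IsSquare (-(2 : ZMod 13)) ∧ IsSquare (-(2 : ZMod 11)) ∧ ((-13 : ℤ) - 2 * 1 ^ 2) % 8 = 1 := by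
  refine ⟨by decide, ⟨3, by decide⟩, by norm_num⟩

/-! ### §4 The all-`N` bound -/

/-- **The all-`N` bound of the census:** if every slot costs at least `w_min ≥ 1` of the budget `Σ_j w_j = 2d + 6`, then
`N ≤ (2d + 6)/w_min` (natural-number division) — the scan's `N_max`; e.g. `2.F4(2).2` `χ₉₂`: `d = 52`, `w_min = 16`, `N ≤ 6`.
research route conditional on HC_CM; not a corollary; Q11.4-sentence-2 already refuted in dim ≥ 3. [folklore] -/
theorem branch_number_le (N d wmin S : ℕ) (hw : 0 < wmin) (hS : S = 2 * d + 6) (hle : N * wmin ≤ S) :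
    N ≤ (2 * d + 6) / wmin := by
  subst hS; exact (Nat.le_div_iff_mul_le hw).2 hle

/-- The instance `2.F4(2).2`, `χ₉₂`: `110 / 16 = 6`. research route conditional on HC_CM; not a corollary; Q11.4-sentence-2 already refuted in dim ≥ 3. [folklore] -/
theorem branch_number_F4 : (2 * 52 + 6) / 16 = 6 := by norm_num

end ResidualClosure

end Summit.HodgeConjecture.HodgeConjecture.Ring2.WeilCoverage

end
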